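import Literature.Claims.NS.Smith2006
import Literature.Analysis.FluidPDE.IsentropicEulerFiniteSpeedOfPropagation

/-!
# D-0090 NS-CLAIMS, claim C06 `Smith2006` — slab calculus for the forcing obstruction (part A of 2)

Cell `ns-claims`; UG CROSS-CHECK PROGRAMME (RULINGS v1.31c (5) / v1.31f (2)); kit typist-12 g3. This
file carries NO statement about the claim: it is the generic calculus of a scalar field `W(t, x)`
that is `C²` on the closed slab `[0, ∞) × ℝ³` in the sense of `Literature.Claims.NS.Smith2006`
(`IsCkOnSlab 2 (Ici 0) W`), used by part B (`SoloRefuteSmith2006Forcing.lean`,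
`not_Theorem2Barriers'`): the space-time gradient `sg W` at interior points, its identification with
the `derivWithin`/`pd` terms of `auxResidualV` and with the order-1 integrand of `IsH22OnSlab`, the
bound `∫_A ‖sg W‖² ≤ K1 W` on compact interior sets, and the Fubini + FTC evaluation of the time
derivative over a cylinder `[a, b] × B̄(0,1)`, bounded by `2M·|B̄(0,1)|` when `|W| ≤ M`.

WHAT THIS IS NOT: not a claim about NS regularity or blow-up; not a claim about any author beyond
the typed locator.
-/

-- The summit's canonical theorem namespace repeats the summit name (single-conjunct summit).
set_option linter.dupNamespace false

noncomputable section

open Set Function MeasureTheory Metric Filter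
open scoped ContDiff ENNReal Topology

namespace Summit.NavierStokesRegularity.NavierStokesRegularity.Theorems.Smith2006

open Literature.Claims.NS.Smith2006

/-! ### The slab `[0, ∞) × ℝ³`, its interior, and the space-time gradient of a `C²`-on-slab field -/

/-- The closed slab `[0, ∞) × ℝ³` of the instance `t̂ = 0`, `T = ∞`. [folklore] -/
abbrev slab : Set (ℝ × R3) := Ici 0 ×ˢ univ

/-- The open slab `(0, ∞) × ℝ³`. [folklore] -/
abbrev slab' : Set (ℝ × R3) := Ioi 0 ×ˢ univ

/-- `(0,∞) × ℝ³ ⊆ [0,∞) × ℝ³`. [folklore] -/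
theorem slab'_subset : slab' ⊆ slab := prod_mono Ioi_subset_Ici_self le_rfl

/-- The open slab is open. [folklore] -/
theorem isOpen_slab' : IsOpen slab' := isOpen_Ioi.prod isOpen_univ

/-- The closed slab is a neighbourhood of every interior point. [folklore] -/
theorem slab_mem_nhds {q : ℝ × R3} (hq : q ∈ slab') : slab ∈ 𝓝 q :=
  mem_of_superset (isOpen_slab'.mem_nhds hq) slab'_subset

/-- Unique differentiability on the closed slab. [folklore] -/
theorem uniqueDiffOn_slab : UniqueDiffOn ℝ slab := (uniqueDiffOn_Ici 0).prod uniqueDiffOn_univ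

/-- The space-time gradient of a scalar field `W(t, x)` at `q = (t, x)`. [folklore] -/
def sg (W : ℝ → R3 → ℝ) (q : ℝ × R3) : ℝ × R3 →L[ℝ] ℝ := fderiv ℝ (uncurry W) q

/-- `|L (1, 0)| ≤ ‖L‖`. [folklore] -/
theorem abs_apply_time_le (L : ℝ × R3 →L[ℝ] ℝ) : |L (1, 0)| ≤ ‖L‖ := by
  rw [← Real.norm_eq_abs]
  exact Literature.Analysis.FluidPDE.IsentropicEuler.norm_apply_one_zero_le L

/-- `|L (0, eₖ)| ≤ ‖L‖`. [folklore] -/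
theorem abs_apply_space_le (L : ℝ × R3 →L[ℝ] ℝ) (k : Fin 3) :
    |L (0, EuclideanSpace.single k 1)| ≤ ‖L‖ := by
  rw [← Real.norm_eq_abs]
  refine (L.le_opNorm _).trans ?_
  have h1 : ‖((0 : ℝ), EuclideanSpace.single k (1 : ℝ))‖ = 1 := by
    simp [Prod.norm_def]
  rw [h1, mul_one]

/-- At interior points the norm of the space-time gradient is the norm of the first within-slab
iterated derivative (the integrand of `IsH22OnSlab` at order 1). [folklore] -/
theorem norm_sg_eq (W : ℝ → R3 → ℝ) {q : ℝ × R3} (hq : q ∈ slab') :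
    ‖sg W q‖ = ‖iteratedFDerivWithin ℝ 1 (uncurry W) slab q‖ := by
  rw [norm_iteratedFDerivWithin_one _ (uniqueDiffOn_slab q (slab'_subset hq)),
    fderivWithin_of_mem_nhds (slab_mem_nhds hq)]
  rfl

section Field

variable {W : ℝ → R3 → ℝ}

/-- A `C²`-on-slab field is Fréchet differentiable at interior points, with derivative `sg W`.
[folklore] -/
theorem hasFDerivAt_sg (hW : IsCkOnSlab 2 (Ici 0) W) {q : ℝ × R3} (hq : q ∈ slab') :
    HasFDerivAt (uncurry W) (sg W q) q :=
  (((hW.differentiableOn (by norm_num)) q (slab'_subset hq)).differentiableAt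
    (slab_mem_nhds hq)).hasFDerivAt

/-- The space-time gradient of a `C²`-on-slab field is continuous on the open slab. [folklore] -/
theorem continuousOn_sg (hW : IsCkOnSlab 2 (Ici 0) W) : ContinuousOn (sg W) slab' :=
  (hW.mono slab'_subset).continuousOn_fderiv_of_isOpen isOpen_slab' (by norm_num)

/-- Time derivative of the slice `s ↦ W s x` at an interior time. [folklore] -/
theorem hasDerivAt_slice (hW : IsCkOnSlab 2 (Ici 0) W) {t : ℝ} (ht : 0 < t) (x : R3) :
    HasDerivAt (fun s => W s x) (sg W (t, x) (1, 0)) t :=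
  Literature.Analysis.FluidPDE.IsentropicEuler.hasDerivAt_slice_left
    (hasFDerivAt_sg hW ⟨ht, mem_univ x⟩)

/-- The within-`[0,∞)` time derivative used by `auxResidualV` is, at interior times, the time
component of the space-time gradient. [folklore] -/
theorem derivWithin_eq_sg (hW : IsCkOnSlab 2 (Ici 0) W) {t : ℝ} (ht : 0 < t) (x : R3) :
    derivWithin (fun s => W s x) (Ici 0) t = sg W (t, x) (1, 0) := by
  rw [derivWithin_of_mem_nhds (Ici_mem_nhds ht)]
  exact (hasDerivAt_slice hW ht x).deriv

/-- The spatial partial `pd` of the slice `W t` is the space component of the space-time gradient.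
[folklore] -/
theorem pd_eq_sg (hW : IsCkOnSlab 2 (Ici 0) W) {t : ℝ} (ht : 0 < t) (x : R3) (k : Fin 3) :
    pd (W t) k x = sg W (t, x) (0, EuclideanSpace.single k 1) := by
  have h := (Literature.Analysis.FluidPDE.IsentropicEuler.hasFDerivAt_slice_right
    (hasFDerivAt_sg hW ⟨ht, mem_univ x⟩)).fderiv
  have hW' : (fun y => uncurry W (t, y)) = W t := rfl
  rw [hW'] at h
  unfold pd
  rw [h]
  simp

/-- The `H^{2,2}` constant at order 1: the (finite) squared `L²(D_∞)` norm of the space-time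
gradient. [folklore] -/
def K1 (W : ℝ → R3 → ℝ) : ℝ :=
  (∫⁻ q in slab, ‖iteratedFDerivWithin ℝ 1 (uncurry W) slab q‖ₑ ^ 2).toReal

/-- `K1 W ≥ 0`. [folklore] -/
theorem K1_nonneg (W : ℝ → R3 → ℝ) : 0 ≤ K1 W := ENNReal.toReal_nonneg

/-- `‖sg W‖²` is integrable on compact subsets of the open slab. [folklore] -/
theorem integrableOn_sg_sq (hW : IsCkOnSlab 2 (Ici 0) W) {A : Set (ℝ × R3)} (hA : A ⊆ slab')
    (hAc : IsCompact A) : IntegrableOn (fun q => ‖sg W q‖ ^ 2) A :=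
  (((continuousOn_sg hW).mono hA).norm.pow 2).integrableOn_compact hAc

/-- On a compact measurable subset of the open slab, `∫ ‖sg W‖² ≤ K1 W` (the global `H^{2,2}`
bound at order 1). [folklore] -/
theorem integral_sg_sq_le (hW : IsCkOnSlab 2 (Ici 0) W) (hH : IsH22OnSlab (Ici 0) W)
    {A : Set (ℝ × R3)} (hAm : MeasurableSet A) (hA : A ⊆ slab') (hAc : IsCompact A) :
    ∫ q in A, ‖sg W q‖ ^ 2 ≤ K1 W := by
  have hint := integrableOn_sg_sq hW hA hAc
  rw [integral_eq_lintegral_of_nonneg_ae (ae_of_all _ fun q => by positivity)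
    hint.aestronglyMeasurable]
  have hfin := hH 1 (by norm_num)
  unfold K1
  refine ENNReal.toReal_mono hfin.ne ?_
  calc ∫⁻ q in A, ENNReal.ofReal (‖sg W q‖ ^ 2)
      = ∫⁻ q in A, ‖iteratedFDerivWithin ℝ 1 (uncurry W) slab q‖ₑ ^ 2 := by
        refine setLIntegral_congr_fun hAm (fun q hq => ?_)
        rw [ENNReal.ofReal_pow (norm_nonneg _), norm_sg_eq W (hA hq), ofReal_norm]
    _ ≤ ∫⁻ q in slab, ‖iteratedFDerivWithin ℝ 1 (uncurry W) slab q‖ₑ ^ 2 :=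
        lintegral_mono_set (hA.trans slab'_subset)

/-- The cylinder `[a, b] × B̄(0,1)` with `0 < a` lies in the open slab. [folklore] -/
theorem cyl_subset {a b : ℝ} (ha : 0 < a) :
    Icc a b ×ˢ closedBall (0 : R3) 1 ⊆ slab' :=
  prod_mono (fun _ ht => ha.trans_le ht.1) (subset_univ _)

/-- The cylinder is compact. [folklore] -/
theorem isCompact_cyl (a b : ℝ) : IsCompact (Icc a b ×ˢ closedBall (0 : R3) 1) :=
  isCompact_Icc.prod (isCompact_closedBall 0 1)

/-- The cylinder is measurable. [folklore] -/
theorem measurableSet_cyl (a b : ℝ) : MeasurableSet (Icc a b ×ˢ closedBall (0 : R3) 1) :=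
  measurableSet_Icc.prod measurableSet_closedBall

/-- The time component of the gradient is integrable on the cylinder. [folklore] -/
theorem integrableOn_sg_time (hW : IsCkOnSlab 2 (Ici 0) W) {a b : ℝ} (ha : 0 < a) :
    IntegrableOn (fun q => sg W q (1, 0)) (Icc a b ×ˢ closedBall (0 : R3) 1) :=
  (((continuousOn_sg hW).mono (cyl_subset ha)).clm_apply continuousOn_const).integrableOn_compact
    (isCompact_cyl a b)

/-- **Fubini + FTC.** On the cylinder `[a, b] × B̄(0,1)` (`0 < a ≤ b`) the time derivative
telescopes and is bounded by `2M · |B̄(0,1)|` when `|W| ≤ M` on the slab. [folklore] -/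
theorem abs_integral_sg_time_le (hW : IsCkOnSlab 2 (Ici 0) W) {M : ℝ}
    (hB : BoundedBySlab M (Ici 0) W)
    {a b : ℝ} (ha : 0 < a) (hab : a ≤ b) :
    |∫ q in Icc a b ×ˢ closedBall (0 : R3) 1, sg W q (1, 0)|
      ≤ 2 * M * volume.real (closedBall (0 : R3) 1) := by
  have hint := integrableOn_sg_time hW (b := b) ha
  -- Fubini: integrate in time first
  have hfub : ∫ q in Icc a b ×ˢ closedBall (0 : R3) 1, sg W q (1, 0)
      = ∫ x in closedBall (0 : R3) 1, ∫ t in Icc a b, sg W (t, x) (1, 0) := by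
    have hint' : Integrable (fun q : ℝ × R3 => sg W q (1, 0))
        ((volume.restrict (Icc a b)).prod (volume.restrict (closedBall (0 : R3) 1))) := by
      rw [Measure.prod_restrict, ← Measure.volume_eq_prod]; exact hint
    have h := integral_prod_symm (fun q : ℝ × R3 => sg W q (1, 0)) hint'
    rw [Measure.prod_restrict, ← Measure.volume_eq_prod] at h
    exact h
  -- FTC per `x`
  have hftc : ∀ x : R3, ∫ t in Icc a b, sg W (t, x) (1, 0) = W b x - W a x := by
    intro x
    rw [integral_Icc_eq_integral_Ioc, ← intervalIntegral.integral_of_le hab]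
    refine intervalIntegral.integral_eq_sub_of_hasDerivAt (f := fun s => W s x)
      (f' := fun t => sg W (t, x) (1, 0)) (fun t ht => ?_) ?_
    · rw [uIcc_of_le hab] at ht
      exact hasDerivAt_slice hW (ha.trans_le ht.1) x
    · refine ContinuousOn.intervalIntegrable ?_
      rw [uIcc_of_le hab]
      have hc : ContinuousOn (fun t : ℝ => (t, x)) (Icc a b) :=
        (continuous_id.prodMk continuous_const).continuousOn
      refine ((continuousOn_sg hW).comp hc fun t ht => ⟨ha.trans_le ht.1, mem_univ _⟩).clm_apply
        continuousOn_const
  have hcongr : ∫ x in closedBall (0 : R3) 1, ∫ t in Icc a b, sg W (t, x) (1, 0)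
      = ∫ x in closedBall (0 : R3) 1, (W b x - W a x) :=
    setIntegral_congr_fun measurableSet_closedBall (fun x _ => hftc x)
  rw [hfub, hcongr]
  have hbound : ∀ x ∈ closedBall (0 : R3) 1, ‖W b x - W a x‖ ≤ 2 * M := by
    intro x _
    have h1 := hB b (show b ∈ Ici (0 : ℝ) from (ha.trans_le hab).le) x
    have h2 := hB a (show a ∈ Ici (0 : ℝ) from ha.le) x
    rw [Real.norm_eq_abs]
    calc |W b x - W a x| ≤ |W b x| + |W a x| := abs_sub _ _
      _ ≤ 2 * M := by linarith
  have hfin : volume (closedBall (0 : R3) 1) < ⊤ := measure_closedBall_lt_top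
  have h := norm_setIntegral_le_of_norm_le_const hfin hbound
  rw [Real.norm_eq_abs] at h
  exact h

end Field

end Summit.NavierStokesRegularity.NavierStokesRegularity.Theorems.Smith2006

end
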